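import Literature.AnabelianGeometry.AbsoluteAnabelian.AbsTopIII.FrobeniusPictureMLFLogGlueBoundary

/-!
# [AbsTopIII] Cor 3.6 (iii): the homotopies of the master family (definition only — feasibility of the
# blueprint's crux; axioms in a sequel)

S. Mochizuki, *Topics in Absolute Anabelian Geometry III*, Cor. 3.6 (iii) pp. 80–81 (kurims manuscript
`paper:url-5493eb38cbb7`; bib key `MochizukiAbsTopIII2015`).  Seat abc-iut-L4-t5 (gen 4), blueprint
`HOME/staging/L4/L4-t5/DISCHARGE-PLAN-Cor36-compat.md`: on a glued pair (`GlueE`) the homotopy is the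
universal one over `ℰ` (pairs into rows 4–6, `coresFamily`) or the PUSHFORWARD of the `𝔖_log` family
`H₃` on `𝒟_{≤3}` (pairs into `𝒩`), the latter typed homogeneously through `𝒟_{≤3} = embLog^*𝒟`
(`sub3_eq_comapAlong`) and the unique lifting of paths (`liftLogPath`).  Definitions + shape lemmas only;
no claim of the paper is asserted.
-/

namespace Literature.AnabelianGeometry.AbsoluteAnabelian

open _root_.CategoryTheory _root_.Quiver

universe u

namespace LogFrobeniusData

open DiagramOfCategories

variable (Δ : LogFrobeniusData.{u})

/-- A glued pair into a core vertex is an `E_W` pair. [cite: MochizukiAbsTopIII2015, Corollary 3.6 (i) p.80] -/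
theorem univE_of_glueE {a b : LFVertex} {P Q : Path a b} (hb : b ≠ LFVertex.third) (h : Δ.GlueE P Q) :
    univE coreVertices P Q := by
  cases h with
  | univ h => exact h
  | log h => exact absurd rfl hb

/-- There is no glued pair into a vertex of the first two rows. [cite: MochizukiAbsTopIII2015, Corollary 3.6 (iii) p.81] -/
theorem glueE_false_of_row_le_two {a b : LFVertex} {P Q : Path a b} (hb : b.row ≤ 2) (h : Δ.GlueE P Q) :
    False := by
  cases h with
  | univ h =>
    obtain ⟨d⟩ := h
    have hs := LFVertex.row_le_of_path d.s
    rcases d.mem with hw | hw | hw <;> rw [hw] at hs <;> simp only [LFVertex.row] at hs hb <;> omega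
  | log h => simp only [LFVertex.row] at hb; omega

/-- There is no path from a vertex of rows `≥ 4` to `𝒩`. [cite: MochizukiAbsTopIII2015, Corollary 3.6 p.78] -/
theorem false_of_path_to_third {a : LFVertex} (ha : 4 ≤ a.row) (P : Path a LFVertex.third) : False := by
  have h : a.row ≤ 3 := LFVertex.row_le_of_path P
  omega

/-- **The `𝔖_log` homotopy pushed forward to `𝒟`** on a pair of LIFTABLE paths into `𝒩` (source in rows
1–3, given as a vertex `a₀` of `𝒟_{≤3}`): for sub3-paths `p, q` with `(p, q) ∈ E_{H₃}`, the homotopy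
`𝒟_{embLog p} ⟶ 𝒟_{embLog q}` obtained from `ζ^{H₃}_{(p,q)}` through `𝒟_{≤3} = embLog^*𝒟`.
[cite: MochizukiAbsTopIII2015, Corollary 3.6 (iii) p.81] -/
noncomputable def pushLogη (H₃ : Δ.sub3.HomotopyFamily) {a₀ b₀ : logObsShape.{u}.Vertex}
    {p q : Path a₀ b₀} (h : H₃.E p q) :
    Δ.diagram.pathFunctor (embLog.mapPath p) ⟶ Δ.diagram.pathFunctor (embLog.mapPath q) :=
  eqToHom (Δ.diagram.pathFunctor_comapAlong embLog p).symm ≫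
    (Δ.sub3_eq_comapAlong ▸ H₃).η
      ((HomotopyFamily.cast_E_iff Δ.sub3_eq_comapAlong H₃ p q).mpr h) ≫
    eqToHom (Δ.diagram.pathFunctor_comapAlong embLog q)

/-- **The homotopy of the master family on a glued pair into `𝒩` from a first-row vertex** (lift the
pair, push the `𝔖_log` homotopy forward). [cite: MochizukiAbsTopIII2015, Corollary 3.6 (iii) p.81] -/
noncomputable def glueηRow1 (H₃ : Δ.sub3.HomotopyFamily)
    (hgen : HomotopyFamily.IsGeneratedBy _ H₃ Δ.LogGen) (n : ℤ)
    (P Q : Path (LFVertex.row1 n) LFVertex.third) (h : Δ.GlueE P Q) :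
    Δ.diagram.pathFunctor P ⟶ Δ.diagram.pathFunctor Q :=
  eqToHom (congrArg Δ.diagram.pathFunctor
      (eq_of_heq (embLog_mapPath_liftLogPath.{u} P le_rfl)).symm) ≫
    Δ.pushLogη H₃ ((hgen _ _).mpr (Δ.saturation_of_glueE_third h)) ≫
    eqToHom (congrArg Δ.diagram.pathFunctor (eq_of_heq (embLog_mapPath_liftLogPath.{u} Q le_rfl)))

/-- … from `□`. [cite: MochizukiAbsTopIII2015, Corollary 3.6 (iii) p.81] -/
noncomputable def glueηNexus (H₃ : Δ.sub3.HomotopyFamily)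
    (hgen : HomotopyFamily.IsGeneratedBy _ H₃ Δ.LogGen)
    (P Q : Path LFVertex.nexus LFVertex.third) (h : Δ.GlueE P Q) :
    Δ.diagram.pathFunctor P ⟶ Δ.diagram.pathFunctor Q :=
  eqToHom (congrArg Δ.diagram.pathFunctor
      (eq_of_heq (embLog_mapPath_liftLogPath.{u} P le_rfl)).symm) ≫
    Δ.pushLogη H₃ ((hgen _ _).mpr (Δ.saturation_of_glueE_third h)) ≫
    eqToHom (congrArg Δ.diagram.pathFunctor (eq_of_heq (embLog_mapPath_liftLogPath.{u} Q le_rfl)))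

/-- … from `𝒩` itself (only the trivial pair). [cite: MochizukiAbsTopIII2015, Corollary 3.6 (iii) p.81] -/
noncomputable def glueηThird (H₃ : Δ.sub3.HomotopyFamily)
    (hgen : HomotopyFamily.IsGeneratedBy _ H₃ Δ.LogGen)
    (P Q : Path LFVertex.third LFVertex.third) (h : Δ.GlueE P Q) :
    Δ.diagram.pathFunctor P ⟶ Δ.diagram.pathFunctor Q :=
  eqToHom (congrArg Δ.diagram.pathFunctor
      (eq_of_heq (embLog_mapPath_liftLogPath.{u} P le_rfl)).symm) ≫
    Δ.pushLogη H₃ ((hgen _ _).mpr (Δ.saturation_of_glueE_third h)) ≫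
    eqToHom (congrArg Δ.diagram.pathFunctor (eq_of_heq (embLog_mapPath_liftLogPath.{u} Q le_rfl)))

/-- **The homotopies of the master family** on the glued boundary set: by the TARGET vertex — through
`ℰ` (`coresFamily`) on pairs into rows 4–6, the pushed-forward `𝔖_log` homotopies on pairs into `𝒩`
(by the source vertex, rows 1–3), nothing into rows 1–2.
[cite: MochizukiAbsTopIII2015, Corollary 3.6 (iii) p.81] -/
noncomputable def glueη (H₃ : Δ.sub3.HomotopyFamily) (hgen : HomotopyFamily.IsGeneratedBy _ H₃ Δ.LogGen) :
    ∀ {a b : LFVertex} {P Q : Path a b}, Δ.GlueE P Q → (Δ.diagram.pathFunctor P ⟶ Δ.diagram.pathFunctor Q)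
  | _, .fourth, _, _, h => Δ.coresFamily.η (Δ.univE_of_glueE (by decide) h)
  | _, .fifth, _, _, h => Δ.coresFamily.η (Δ.univE_of_glueE (by decide) h)
  | _, .sixth, _, _, h => Δ.coresFamily.η (Δ.univE_of_glueE (by decide) h)
  | .row1 n, .third, P, Q, h => Δ.glueηRow1 H₃ hgen n P Q h
  | .nexus, .third, P, Q, h => Δ.glueηNexus H₃ hgen P Q h
  | .third, .third, P, Q, h => Δ.glueηThird H₃ hgen P Q h
  | .fourth, .third, P, _, _ => (false_of_path_to_third (by decide) P).elim
  | .fifth, .third, P, _, _ => (false_of_path_to_third (by decide) P).elim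
  | .sixth, .third, P, _, _ => (false_of_path_to_third (by decide) P).elim
  | _, .row1 _, _, _, h => (Δ.glueE_false_of_row_le_two (by simp [LFVertex.row]) h).elim
  | _, .nexus, _, _, h => (Δ.glueE_false_of_row_le_two (by simp [LFVertex.row]) h).elim

end LogFrobeniusData

end Literature.AnabelianGeometry.AbsoluteAnabelian

namespace Literature.AnabelianGeometry.AbsoluteAnabelian

open _root_.CategoryTheory _root_.Quiver

universe u

namespace LogFrobeniusData

open DiagramOfCategories

variable (Δ : LogFrobeniusData.{u})

/-! ### The identity law for the glued homotopies -/

/-- `eqToHom` bookkeeping: an identity sandwiched between inverse `eqToHom`s is an identity (closed by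
`exact`, which unifies the category instances up to definitional unfolding). [folklore] -/
private theorem eqToHom_id_eqToHom {C : Type*} [Category C] {a b : C} (h₁ : a = b) (h₂ : b = a) :
    eqToHom h₁ ≫ 𝟙 b ≫ eqToHom h₂ = 𝟙 a := by
  cases h₁; simp

/-- The pushed-forward `𝔖_log` homotopy of a diagonal pair is the identity.
[cite: MochizukiAbsTopIII2015, Definition 3.5 (ii) p.75] -/
theorem pushLogη_refl (H₃ : Δ.sub3.HomotopyFamily) {a₀ b₀ : logObsShape.{u}.Vertex} {p : Path a₀ b₀}
    (h : H₃.E p p) : Δ.pushLogη H₃ h = 𝟙 _ := by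
  unfold pushLogη
  have href := (Δ.sub3_eq_comapAlong ▸ H₃).η_refl
    ((HomotopyFamily.cast_E_iff Δ.sub3_eq_comapAlong H₃ p p).mpr h)
  rw [href]
  exact eqToHom_id_eqToHom _ _

/-- **Identity law** (Def. 3.5 (ii): `ζ_{([γ],[γ])}` is the identity) for the glued homotopies.
[cite: MochizukiAbsTopIII2015, Definition 3.5 (ii) p.75] -/
theorem glueη_refl (H₃ : Δ.sub3.HomotopyFamily) (hgen : HomotopyFamily.IsGeneratedBy _ H₃ Δ.LogGen)
    {a b : LFVertex} {P : Path a b} (h : Δ.GlueE P P) : Δ.glueη H₃ hgen h = 𝟙 _ := by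
  rcases b with _ | _ | _ | _ | _ | _
  · exact (Δ.glueE_false_of_row_le_two (by simp [LFVertex.row]) h).elim
  · exact (Δ.glueE_false_of_row_le_two (by simp [LFVertex.row]) h).elim
  · rcases a with _ | _ | _ | _ | _ | _
    · show Δ.glueηRow1 H₃ hgen _ P P h = 𝟙 _
      unfold glueηRow1
      rw [Δ.pushLogη_refl]
      exact eqToHom_id_eqToHom _ _
    · show Δ.glueηNexus H₃ hgen P P h = 𝟙 _
      unfold glueηNexus
      rw [Δ.pushLogη_refl]
      exact eqToHom_id_eqToHom _ _
    · show Δ.glueηThird H₃ hgen P P h = 𝟙 _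
      unfold glueηThird
      rw [Δ.pushLogη_refl]
      exact eqToHom_id_eqToHom _ _
    · exact (false_of_path_to_third (by decide) P).elim
    · exact (false_of_path_to_third (by decide) P).elim
    · exact (false_of_path_to_third (by decide) P).elim
  · exact Δ.coresFamily.η_refl _
  · exact Δ.coresFamily.η_refl _
  · exact Δ.coresFamily.η_refl _

/-! ### The composition law for the glued homotopies -/

/-- `eqToHom` bookkeeping: composing two `eqToHom`-sandwiches with matching middle cancels the inner pair
(closed by `cases`/`simp` in a generic category, applied by `exact`). [folklore] -/
private theorem sandwich_comp_sandwich {C : Type*} [Category C] {a a' b b' c c' : C}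
    (f : a' ⟶ b') (g : b' ⟶ c') (h₁ : a = a') (h₂ : b' = b) (h₃ : b = b') (h₄ : c' = c) :
    (eqToHom h₁ ≫ f ≫ eqToHom h₂) ≫ (eqToHom h₃ ≫ g ≫ eqToHom h₄) =
      eqToHom h₁ ≫ (f ≫ g) ≫ eqToHom h₄ := by
  cases h₁; cases h₂; cases h₄; simp

/-- `eqToHom` bookkeeping: if `X = Y ≫ Z` then the `eqToHom`-sandwich of `X` is the composite of the
sandwiches of `Y` and `Z` with cancelling middle (applied by `exact`). [folklore] -/
private theorem sandwich_eq_comp {C : Type*} [Category C] {a a' b b' c c' : C}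
    {X : a' ⟶ c'} {Y : a' ⟶ b'} {Z : b' ⟶ c'} (hX : X = Y ≫ Z)
    (h₁ : a = a') (h₂ : b' = b) (h₃ : b = b') (h₄ : c' = c) :
    eqToHom h₁ ≫ X ≫ eqToHom h₄ = (eqToHom h₁ ≫ Y ≫ eqToHom h₂) ≫ (eqToHom h₃ ≫ Z ≫ eqToHom h₄) := by
  cases h₁; cases h₂; cases h₄; simp [hX]

/-- The pushed-forward `𝔖_log` homotopies compose (Def. 3.5 (ii): `ζ_{ϖ''} = ζ_{ϖ'} ∘ ζ_ϖ`).
[cite: MochizukiAbsTopIII2015, Definition 3.5 (ii) p.75] -/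
theorem pushLogη_trans (H₃ : Δ.sub3.HomotopyFamily) {a₀ b₀ : logObsShape.{u}.Vertex} {p q r : Path a₀ b₀}
    (h₁ : H₃.E p q) (h₂ : H₃.E q r) :
    Δ.pushLogη H₃ (H₃.isSaturated.trans h₁ h₂) = Δ.pushLogη H₃ h₁ ≫ Δ.pushLogη H₃ h₂ := by
  unfold pushLogη
  have htr := (Δ.sub3_eq_comapAlong ▸ H₃).η_trans
    ((HomotopyFamily.cast_E_iff Δ.sub3_eq_comapAlong H₃ p q).mpr h₁)
    ((HomotopyFamily.cast_E_iff Δ.sub3_eq_comapAlong H₃ q r).mpr h₂)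
  rw [sandwich_comp_sandwich, ← htr]

/-- **Composition law** (Def. 3.5 (ii)) for the glued homotopies.
[cite: MochizukiAbsTopIII2015, Definition 3.5 (ii) p.75] -/
theorem glueη_trans (H₃ : Δ.sub3.HomotopyFamily) (hgen : HomotopyFamily.IsGeneratedBy _ H₃ Δ.LogGen)
    {a b : LFVertex} {P Q R : Path a b} (h₁ : Δ.GlueE P Q) (h₂ : Δ.GlueE Q R) :
    Δ.glueη H₃ hgen (Δ.isSaturated_glueE.trans h₁ h₂) = Δ.glueη H₃ hgen h₁ ≫ Δ.glueη H₃ hgen h₂ := by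
  rcases b with _ | _ | _ | _ | _ | _
  · exact (Δ.glueE_false_of_row_le_two (by simp [LFVertex.row]) h₁).elim
  · exact (Δ.glueE_false_of_row_le_two (by simp [LFVertex.row]) h₁).elim
  · rcases a with _ | _ | _ | _ | _ | _
    · show Δ.glueηRow1 H₃ hgen _ P R (Δ.isSaturated_glueE.trans h₁ h₂) =
          Δ.glueηRow1 H₃ hgen _ P Q h₁ ≫ Δ.glueηRow1 H₃ hgen _ Q R h₂
      unfold glueηRow1
      exact sandwich_eq_comp (Δ.pushLogη_trans H₃ (p := liftLogPath.{u} P le_rfl)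
        (q := liftLogPath.{u} Q le_rfl) (r := liftLogPath.{u} R le_rfl) _ _) _ _ _ _
    · show Δ.glueηNexus H₃ hgen P R (Δ.isSaturated_glueE.trans h₁ h₂) =
          Δ.glueηNexus H₃ hgen P Q h₁ ≫ Δ.glueηNexus H₃ hgen Q R h₂
      unfold glueηNexus
      exact sandwich_eq_comp (Δ.pushLogη_trans H₃ (p := liftLogPath.{u} P le_rfl)
        (q := liftLogPath.{u} Q le_rfl) (r := liftLogPath.{u} R le_rfl) _ _) _ _ _ _
    · show Δ.glueηThird H₃ hgen P R (Δ.isSaturated_glueE.trans h₁ h₂) =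
          Δ.glueηThird H₃ hgen P Q h₁ ≫ Δ.glueηThird H₃ hgen Q R h₂
      unfold glueηThird
      exact sandwich_eq_comp (Δ.pushLogη_trans H₃ (p := liftLogPath.{u} P le_rfl)
        (q := liftLogPath.{u} Q le_rfl) (r := liftLogPath.{u} R le_rfl) _ _) _ _ _ _
    · exact (false_of_path_to_third (by decide) P).elim
    · exact (false_of_path_to_third (by decide) P).elim
    · exact (false_of_path_to_third (by decide) P).elim
  · exact Δ.coresFamily.η_trans _ _
  · exact Δ.coresFamily.η_trans _ _
  · exact Δ.coresFamily.η_trans _ _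

end LogFrobeniusData

end Literature.AnabelianGeometry.AbsoluteAnabelian
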